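import Summits.CriticalPhenomena.PercolationContinuityZ3.Theorems.PercNearOneGluingNoHeavyPcintNawMemorySixDeficit
import Summits.CriticalPhenomena.PercolationContinuityZ3.Theorems.PercNearOneGluingNoHeavyPcintLoopExclusionSitePolygons
import HarnessLib

/-!
# CriticalPhenomena/PercolationContinuityZ3 — Theorems/PercNearOneGluingNoHeavyPcintNawMemorySixStrict.lean: STRICT MONOTONICITY OF THE SITE HIERARCHY AT THE SECOND RUNG — `μ^N_6(d)⁶ ≤ μ^N_4(d)⁶ − 1/2`, so `μ^N_6(d) < μ^N_4(d)`, `Δ^N_6(d) > 0`, `R^N_6(d) > 0` for every `d ≥ 3`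

Lane prim-pcint, STRUCTURE rule; the site twin of …PcintMemorySixStrict.  `λ = μ^N_4(d) = (d−1) + √((d−1)²+1)`
(`NawTail.nawMemGrowth_four_eq`) is the Perron root of the two-class recursion `S' ≤ S + T`, `T' ≤ (2d−2)S + (2d−3)T` of
memory-4 neighbour-avoiding words (…PcintNawMemoryFour); its LEFT Perron vector is `ℓ = (λ − 2d + 3, 1)` (`ℓM = λℓ` is the
quadratic `λ² = (2d−2)λ + 1`).  With the restricted recursion and the chair-hexagon continuation of
…PcintNawMemorySixDeficit:

* `sitePotential_ext_le`: `Ψ(one-step extensions of S) ≤ λ · Ψ(S)`, `Ψ(S) = ℓ_S #(S ∩ S) + #(S ∩ T)`;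
* `sitePotential_six_step_six`: `Ψ(W⁶_{n+8}) ≤ λ⁶ Ψ(W⁶_{n+2}) − #W⁶_{n+2} ≤ (λ⁶ − 1/2) Ψ(W⁶_{n+2})` (the chair continuations are
  memory-4 extensions of class `T`, weight `1`, disjoint from the memory-6 words; `ℓ_S ≤ 2` is the largest weight);
* **`nawMemGrowth_six_pow_six_le`: `μ^N_6(d)⁶ ≤ μ^N_4(d)⁶ − 1/2`**, **`nawMemGrowth_six_lt_four`: `μ^N_6(d) < μ^N_4(d)`**,
  **`siteLoopCost_six_pos`: `Δ^N_6(d) > 0`**, **`siteLoopCompat_six_pos`: `R^N_6(d) > 0`**, `siteLoopCompatWindow_rung_six_left`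
  — every `d ≥ 3` (at `d = 2` there is no chordless hexagon and the site law is typed for `d ≥ 3`).

HONEST FRAMING: elementary; nothing here is used by a certified `p_c` cell.  Written by prim-pcint-2 gen 17
(prover-prim-pcint-2-g17-0), 2026-08-25.
-/

noncomputable section

open Filter Topology
open Literature.Probability.LatticeModels Literature.Probability.Percolation
open Summit.CriticalPhenomena.PercolationContinuityZ3.Theorems.Pcint

namespace Summit.CriticalPhenomena.PercolationContinuityZ3.Theorems.Pcint.NawTail

variable {d : ℕ}

/-- The left Perron weight of class `S` (class `T` has weight `1`) and the weighted class count `Ψ`. -/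
local notation "ℓS" => (nawMemGrowth d 4 - (2 * (d : ℝ) - 3))
set_option quotPrecheck false in
local notation "Ψ[" m "](" S ")" =>
  ((nawMemGrowth d 4 - (2 * (d : ℝ) - 3)) * ((Finset.card (Finset.filter (fun v => v ∈ nawFourS d m) S) : ℕ) : ℝ)
    + ((Finset.card (Finset.filter (fun v => v ∈ nawFourT d m) S) : ℕ) : ℝ))

/-! ### The Perron root and the weights -/

/-- **`λ² = (2d−2)λ + 1`** for `λ = μ^N_4(d)`, `d ≥ 2`. [folklore] -/
theorem nawMemGrowth_four_sq (hd : 2 ≤ d) :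
    nawMemGrowth d 4 ^ 2 = (2 * (d : ℝ) - 2) * nawMemGrowth d 4 + 1 := by
  have h := nawMemGrowth_four_eq hd
  have hs : Real.sqrt (((d : ℝ) - 1) ^ 2 + 1) ^ 2 = ((d : ℝ) - 1) ^ 2 + 1 := Real.sq_sqrt (by positivity)
  rw [h]; nlinarith [hs]

/-- `2d − 2 ≤ λ < 2d − 1`, so `1 ≤ ℓ_S ≤ 2`. [folklore] -/
theorem siteWeight_bounds (hd : 2 ≤ d) : 1 ≤ ℓS ∧ ℓS ≤ 2 := by
  have hd' : (2 : ℝ) ≤ d := by exact_mod_cast hd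
  have h := nawMemGrowth_four_eq hd
  have hs : (d : ℝ) - 1 ≤ Real.sqrt (((d : ℝ) - 1) ^ 2 + 1) := by
    rw [Real.le_sqrt (by linarith) (by positivity)]
    linarith
  have hlt := nawMemGrowth_four_lt hd
  constructor <;> linarith

/-! ### The potential inequality for one-step extensions -/

/-- The class sub-families of the one-step extensions of `S` are the extension families of the classes. [folklore] -/
theorem filter_nawExt_eq {m : ℕ} (S : Finset (Fin (m + 2) → Fin d × Bool)) (E : Finset (Fin (m + 3) → Fin d × Bool))
    (hE : E ⊆ nawFourWords d (m + 3)) :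
    ((nawFourWords d (m + 3)).filter fun v => wordInit' v ∈ S).filter (fun v => v ∈ E)
      = E.filter fun v => wordInit' v ∈ S := by
  ext v
  simp only [Finset.mem_filter]
  constructor
  · rintro ⟨⟨_, h2⟩, h3⟩; exact ⟨h3, h2⟩
  · rintro ⟨h1, h2⟩; exact ⟨⟨hE h1, h2⟩, h1⟩

/-- **`Ψ(one-step extensions of S) ≤ μ^N_4(d) · Ψ(S)`** for every set `S ⊆ nawFourWords d (m+2)`. [folklore] -/
theorem sitePotential_ext_le (hd : 2 ≤ d) {m : ℕ} (S : Finset (Fin (m + 2) → Fin d × Bool))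
    (hS : S ⊆ nawFourWords d (m + 2)) :
    Ψ[m + 1](((nawFourWords d (m + 3)).filter fun v => wordInit' v ∈ S)) ≤ nawMemGrowth d 4 * Ψ[m](S) := by
  classical
  obtain ⟨hS1, hS2⟩ := siteWeight_bounds hd
  have hsq := nawMemGrowth_four_sq hd
  have hd3 : 3 ≤ 2 * d := by omega
  rw [filter_nawExt_eq S (nawFourS d (m + 1)) (Finset.filter_subset _ _),
    filter_nawExt_eq S (nawFourT d (m + 1)) (Finset.filter_subset _ _)]
  have hs := card_nawFourS_succ_filter_le (d := d) S
  have ht := card_nawFourT_succ_filter_le (d := d) S hS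
  have hpart := card_filter_nawFourST S hS
  set s := ((S.filter fun u => u ∈ nawFourS d m).card : ℝ) with hs'
  set t := ((S.filter fun u => u ∈ nawFourT d m).card : ℝ) with ht'
  have hs_r : (((nawFourS d (m + 1)).filter fun w => wordInit' w ∈ S).card : ℝ) ≤ s + t := by
    have : (((nawFourS d (m + 1)).filter fun w => wordInit' w ∈ S).card : ℝ) ≤ (S.card : ℝ) := by exact_mod_cast hs
    rw [← hpart] at this; push_cast at this; linarith
  have ht_r : (((nawFourT d (m + 1)).filter fun w => wordInit' w ∈ S).card : ℝ) ≤ (2 * d - 2) * s + (2 * d - 3) * t := by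
    have := (Nat.cast_le (α := ℝ)).2 ht
    rw [Nat.cast_add, Nat.cast_mul, Nat.cast_mul, Nat.cast_sub (by omega), Nat.cast_sub hd3] at this
    push_cast at this
    rw [hs', ht']; linarith
  have e1 := mul_le_mul_of_nonneg_left hs_r (by linarith : (0 : ℝ) ≤ ℓS)
  calc ℓS * (((nawFourS d (m + 1)).filter fun w => wordInit' w ∈ S).card : ℝ)
        + (((nawFourT d (m + 1)).filter fun w => wordInit' w ∈ S).card : ℝ)
      ≤ ℓS * (s + t) + ((2 * d - 2) * s + (2 * d - 3) * t) := by linarith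
    _ = (ℓS + (2 * (d : ℝ) - 2)) * s + (ℓS + (2 * (d : ℝ) - 3)) * t := by ring
    _ = nawMemGrowth d 4 * (ℓS * s + t) := by nlinarith [hsq]

/-! ### Memory-6 neighbour-avoiding words and the six-step deficit -/

/-- Neighbour-avoidance memory 6 implies the memory-4 predicate `IsNAWFour`. [folklore] -/
theorem isNAWFour_of_isNawMem_six {m : ℕ} {v : Fin m → Fin d × Bool} (h : IsNawMem 6 v) : IsNAWFour v :=
  isNAWFour_of_isNawMem (h.anti (by omega))

/-- `nawMemWords d 6 m ⊆ nawFourWords d m`. [folklore] -/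
theorem nawMemWords_six_subset (d m : ℕ) : nawMemWords d 6 m ⊆ nawFourWords d m := fun _ hv =>
  mem_nawFourWords.2 (isNAWFour_of_isNawMem_six (mem_nawMemWords.1 hv))

/-- `#S ≤ Ψ(S) ≤ ℓ_S · #S` for `S ⊆ nawFourWords`. [folklore] -/
theorem card_le_sitePotential_le (hd : 2 ≤ d) {m : ℕ} (S : Finset (Fin (m + 2) → Fin d × Bool))
    (hS : S ⊆ nawFourWords d (m + 2)) : (S.card : ℝ) ≤ Ψ[m](S) ∧ Ψ[m](S) ≤ ℓS * S.card := by
  obtain ⟨hS1, hS2⟩ := siteWeight_bounds hd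
  have hpart := card_filter_nawFourST S hS
  have h : (S.card : ℝ) = ((S.filter fun u => u ∈ nawFourS d m).card : ℝ) + ((S.filter fun u => u ∈ nawFourT d m).card : ℝ) := by
    exact_mod_cast hpart.symm
  have h0 := Nat.cast_nonneg (α := ℝ) (S.filter fun u => u ∈ nawFourS d m).card
  have h1 := Nat.cast_nonneg (α := ℝ) (S.filter fun u => u ∈ nawFourT d m).card
  rw [h]
  constructor <;> nlinarith

/-- **The six-step deficit inequality**: `Ψ(W⁶_{n+8}) ≤ (μ^N_4⁶ − 1/2) · Ψ(W⁶_{n+2})` for `d ≥ 3`, `W⁶_m = nawMemWords d 6 m`.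
[folklore] -/
theorem sitePotential_six_step_six (hd : 3 ≤ d) (n : ℕ) :
    Ψ[n + 6](nawMemWords d 6 (n + 8)) ≤ (nawMemGrowth d 4 ^ 6 - 1 / 2) * Ψ[n](nawMemWords d 6 (n + 2)) := by
  classical
  have hd2 : 2 ≤ d := by omega
  set lam := nawMemGrowth d 4 with hlam
  obtain ⟨hS1, hS2⟩ := siteWeight_bounds hd2
  have hd' : (3 : ℝ) ≤ d := by exact_mod_cast hd
  have hlam1 : (1 : ℝ) ≤ lam := by linarith
  have hlam0 : (0 : ℝ) ≤ lam := by linarith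
  -- the chain of extension families
  set S0 : Finset (Fin (n + 2) → Fin d × Bool) := nawMemWords d 6 (n + 2) with hS0
  set S1 := (nawFourWords d (n + 3)).filter fun v => wordInit' v ∈ S0 with hS1d
  set S2 := (nawFourWords d (n + 4)).filter fun v => wordInit' v ∈ S1 with hS2d
  set S3 := (nawFourWords d (n + 5)).filter fun v => wordInit' v ∈ S2 with hS3d
  set S4 := (nawFourWords d (n + 6)).filter fun v => wordInit' v ∈ S3 with hS4d
  set S5 := (nawFourWords d (n + 7)).filter fun v => wordInit' v ∈ S4 with hS5d
  set S6 := (nawFourWords d (n + 8)).filter fun v => wordInit' v ∈ S5 with hS6d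
  have hS0m : S0 ⊆ nawFourWords d (n + 2) := nawMemWords_six_subset d _
  have h1 : Ψ[n + 1](S1) ≤ lam * Ψ[n](S0) := sitePotential_ext_le hd2 S0 hS0m
  have h2 : Ψ[n + 2](S2) ≤ lam * Ψ[n + 1](S1) := sitePotential_ext_le hd2 S1 (Finset.filter_subset _ _)
  have h3 : Ψ[n + 3](S3) ≤ lam * Ψ[n + 2](S2) := sitePotential_ext_le hd2 S2 (Finset.filter_subset _ _)
  have h4 : Ψ[n + 4](S4) ≤ lam * Ψ[n + 3](S3) := sitePotential_ext_le hd2 S3 (Finset.filter_subset _ _)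
  have h5 : Ψ[n + 5](S5) ≤ lam * Ψ[n + 4](S4) := sitePotential_ext_le hd2 S4 (Finset.filter_subset _ _)
  have h6 : Ψ[n + 6](S6) ≤ lam * Ψ[n + 5](S5) := sitePotential_ext_le hd2 S5 (Finset.filter_subset _ _)
  have h16 : Ψ[n + 6](S6) ≤ lam ^ 6 * Ψ[n](S0) := by
    calc Ψ[n + 6](S6) ≤ lam * Ψ[n + 5](S5) := h6
      _ ≤ lam * (lam * Ψ[n + 4](S4)) := mul_le_mul_of_nonneg_left h5 hlam0
      _ ≤ lam * (lam * (lam * Ψ[n + 3](S3))) := by gcongr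
      _ ≤ lam * (lam * (lam * (lam * Ψ[n + 2](S2)))) := by gcongr
      _ ≤ lam * (lam * (lam * (lam * (lam * Ψ[n + 1](S1))))) := by gcongr
      _ ≤ lam * (lam * (lam * (lam * (lam * (lam * Ψ[n](S0)))))) := by gcongr
      _ = lam ^ 6 * Ψ[n](S0) := by ring
  -- membership in S6
  have m1 : ∀ u, u ∈ S1 ↔ IsNAWFour u ∧ wordInit' u ∈ S0 := fun u => by rw [hS1d, Finset.mem_filter, mem_nawFourWords]
  have m2 : ∀ u, u ∈ S2 ↔ IsNAWFour u ∧ wordInit' u ∈ S1 := fun u => by rw [hS2d, Finset.mem_filter, mem_nawFourWords]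
  have m3 : ∀ u, u ∈ S3 ↔ IsNAWFour u ∧ wordInit' u ∈ S2 := fun u => by rw [hS3d, Finset.mem_filter, mem_nawFourWords]
  have m4 : ∀ u, u ∈ S4 ↔ IsNAWFour u ∧ wordInit' u ∈ S3 := fun u => by rw [hS4d, Finset.mem_filter, mem_nawFourWords]
  have m5 : ∀ u, u ∈ S5 ↔ IsNAWFour u ∧ wordInit' u ∈ S4 := fun u => by rw [hS5d, Finset.mem_filter, mem_nawFourWords]
  have m6 : ∀ u, u ∈ S6 ↔ IsNAWFour u ∧ wordInit' u ∈ S5 := fun u => by rw [hS6d, Finset.mem_filter, mem_nawFourWords]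
  have hmem6 : ∀ v : Fin (n + 8) → Fin d × Bool, IsNAWFour v →
      wordInit' (wordInit' (wordInit' (wordInit' (wordInit' (wordInit' v))))) ∈ S0 → v ∈ S6 := by
    intro v hv h0
    have i1 := hv.wordInit'
    have i2 := i1.wordInit'
    have i3 := i2.wordInit'
    have i4 := i3.wordInit'
    have i5 := i4.wordInit'
    exact (m6 _).2 ⟨hv, (m5 _).2 ⟨i1, (m4 _).2 ⟨i2, (m3 _).2 ⟨i3, (m2 _).2 ⟨i4, (m1 _).2 ⟨i5, h0⟩⟩⟩⟩⟩⟩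
  have hW6 : nawMemWords d 6 (n + 8) ⊆ S6 := by
    intro v hv
    have h6v : IsNawMem 6 v := mem_nawMemWords.1 hv
    refine hmem6 v (isNAWFour_of_isNawMem_six h6v) ?_
    rw [hS0, mem_nawMemWords]
    exact isNawMem_wordInit' (isNawMem_wordInit' (isNawMem_wordInit' (isNawMem_wordInit'
      (isNawMem_wordInit' (isNawMem_wordInit' h6v)))))
  -- the chair continuations
  obtain ⟨c, hcinj, hcpre, hcmem, hcT, hc6⟩ := chair_continuation hd n
  have hcS6 : ∀ w ∈ S0, c w ∈ S6 := by
    intro w hw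
    have hw4 : IsNAWFour w := isNAWFour_of_isNawMem_six (by rw [hS0, mem_nawMemWords] at hw; exact hw)
    refine hmem6 (c w) (hcmem w hw4) ?_
    have : wordInit' (wordInit' (wordInit' (wordInit' (wordInit' (wordInit' (c w)))))) = w := by
      funext i; exact hcpre w i
    rw [this]; exact hw
  have hTcount : (((nawMemWords d 6 (n + 8)).filter fun v => v ∈ nawFourT d (n + 6)).card : ℝ) + (S0.card : ℝ)
      ≤ ((S6.filter fun v => v ∈ nawFourT d (n + 6)).card : ℝ) := by
    have himg : (S0.image c).card = S0.card := Finset.card_image_of_injective _ hcinj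
    have hdisj : Disjoint ((nawMemWords d 6 (n + 8)).filter fun v => v ∈ nawFourT d (n + 6)) (S0.image c) := by
      rw [Finset.disjoint_left]
      intro v hv hv'
      rw [Finset.mem_image] at hv'
      obtain ⟨w, -, rfl⟩ := hv'
      rw [Finset.mem_filter, mem_nawMemWords] at hv
      exact hc6 w hv.1
    have hsub : ((nawMemWords d 6 (n + 8)).filter fun v => v ∈ nawFourT d (n + 6)) ∪ S0.image c
        ⊆ S6.filter fun v => v ∈ nawFourT d (n + 6) := by
      intro v hv
      rw [Finset.mem_union] at hv
      rw [Finset.mem_filter]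
      rcases hv with hv | hv
      · rw [Finset.mem_filter] at hv; exact ⟨hW6 hv.1, hv.2⟩
      · rw [Finset.mem_image] at hv
        obtain ⟨w, hw, rfl⟩ := hv
        have hw4 : IsNAWFour w := isNAWFour_of_isNawMem_six (by rw [hS0, mem_nawMemWords] at hw; exact hw)
        refine ⟨hcS6 w hw, ?_⟩
        rw [nawFourT, Finset.mem_filter, mem_nawFourWords]
        exact ⟨hcmem w hw4, hcT w⟩
    have := Finset.card_le_card hsub
    rw [Finset.card_union_of_disjoint hdisj, himg] at this
    exact_mod_cast this
  have hScount : (((nawMemWords d 6 (n + 8)).filter fun v => v ∈ nawFourS d (n + 6)).card : ℝ)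
      ≤ ((S6.filter fun v => v ∈ nawFourS d (n + 6)).card : ℝ) := by
    exact_mod_cast Finset.card_le_card (Finset.filter_subset_filter _ hW6)
  have hΨS0 := (card_le_sitePotential_le hd2 S0 hS0m).2
  have eS := mul_le_mul_of_nonneg_left hScount (by linarith : (0 : ℝ) ≤ ℓS)
  -- Ψ(W) ≤ Ψ(S6) − #S0 ≤ lam^6 Ψ(S0) − #S0 and #S0 ≥ Ψ(S0)/2
  have hΨ0 : 0 ≤ Ψ[n](S0) := by
    have := (card_le_sitePotential_le hd2 S0 hS0m).1
    linarith [Nat.cast_nonneg (α := ℝ) S0.card]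
  nlinarith [eS, hTcount, h16, hΨS0, hS2, hΨ0]

/-- `μ^N_τ(d)^n ≤ N_{n,τ}(d)` for `n ≥ 1` (from the infimum form of `nawMemGrowth`). [folklore] -/
theorem pow_nawMemGrowth_le (d τ : ℕ) {n : ℕ} (hn : n ≠ 0) : nawMemGrowth d τ ^ n ≤ (nawMemCount d τ n : ℝ) := by
  have h := nawMemGrowth_le_rpow d τ hn
  have h0 := nawMemGrowth_nonneg d τ
  have hN : (0 : ℝ) ≤ nawMemCount d τ n := Nat.cast_nonneg _
  calc nawMemGrowth d τ ^ n ≤ ((nawMemCount d τ n : ℝ) ^ (1 / (n : ℝ))) ^ n := pow_le_pow_left₀ h0 h n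
    _ = (nawMemCount d τ n : ℝ) := by
        rw [← Real.rpow_natCast, ← Real.rpow_mul hN, one_div_mul_cancel (by exact_mod_cast hn), Real.rpow_one]

/-- **`N_{6j+2,6}(d) ≤ 2(2d)² (μ^N_4⁶ − 1/2)^j`** for `d ≥ 3`. [folklore] -/
theorem nawMemCount_six_le (hd : 3 ≤ d) (j : ℕ) :
    (nawMemCount d 6 (6 * j + 2) : ℝ) ≤ 2 * (2 * d) ^ 2 * (nawMemGrowth d 4 ^ 6 - 1 / 2) ^ j := by
  have hd2 : 2 ≤ d := by omega
  have hd' : (2 : ℝ) ≤ d := by exact_mod_cast hd2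
  obtain ⟨hS1, hS2⟩ := siteWeight_bounds hd2
  have hq : (0 : ℝ) ≤ nawMemGrowth d 4 ^ 6 - 1 / 2 := by
    have : (1 : ℝ) ≤ nawMemGrowth d 4 ^ 6 := one_le_pow₀ (by linarith)
    linarith
  set f : ℕ → ℝ := fun n => Ψ[n](nawMemWords d 6 (n + 2)) with hf
  have hstep : ∀ n : ℕ, f (n + 6) ≤ (nawMemGrowth d 4 ^ 6 - 1 / 2) * f n := fun n => sitePotential_six_step_six hd n
  have hiter : ∀ j : ℕ, f (6 * j) ≤ (nawMemGrowth d 4 ^ 6 - 1 / 2) ^ j * f 0 := by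
    intro j
    induction j with
    | zero => simp
    | succ j ih =>
      rw [show 6 * (j + 1) = 6 * j + 6 by ring]
      calc f (6 * j + 6) ≤ (nawMemGrowth d 4 ^ 6 - 1 / 2) * f (6 * j) := hstep (6 * j)
        _ ≤ (nawMemGrowth d 4 ^ 6 - 1 / 2) * ((nawMemGrowth d 4 ^ 6 - 1 / 2) ^ j * f 0) :=
            mul_le_mul_of_nonneg_left ih hq
        _ = (nawMemGrowth d 4 ^ 6 - 1 / 2) ^ (j + 1) * f 0 := by ring
  have h0 : f 0 ≤ 2 * (2 * d) ^ 2 := by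
    show Ψ[0](nawMemWords d 6 (0 + 2)) ≤ _
    refine (card_le_sitePotential_le hd2 (nawMemWords d 6 2) (nawMemWords_six_subset d 2)).2.trans ?_
    have hc : ((nawMemWords d 6 2).card : ℝ) ≤ (2 * d) ^ 2 := by
      have := nawMemCount_le_pow d 6 2
      unfold nawMemCount at this
      exact_mod_cast this
    nlinarith [Nat.cast_nonneg (α := ℝ) (nawMemWords d 6 2).card]
  calc (nawMemCount d 6 (6 * j + 2) : ℝ) = ((nawMemWords d 6 (6 * j + 2)).card : ℝ) := by rfl
    _ ≤ f (6 * j) := (card_le_sitePotential_le hd2 _ (nawMemWords_six_subset d _)).1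
    _ ≤ (nawMemGrowth d 4 ^ 6 - 1 / 2) ^ j * f 0 := hiter j
    _ ≤ (nawMemGrowth d 4 ^ 6 - 1 / 2) ^ j * (2 * (2 * d) ^ 2) := mul_le_mul_of_nonneg_left h0 (pow_nonneg hq j)
    _ = 2 * (2 * d) ^ 2 * (nawMemGrowth d 4 ^ 6 - 1 / 2) ^ j := by ring

/-! ### Strict monotonicity of the site hierarchy at the second rung -/

/-- **`μ^N_6(d)⁶ ≤ μ^N_4(d)⁶ − 1/2`** for every `d ≥ 3`. [folklore] -/
theorem nawMemGrowth_six_pow_six_le (hd : 3 ≤ d) : nawMemGrowth d 6 ^ 6 ≤ nawMemGrowth d 4 ^ 6 - 1 / 2 := by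
  haveI : NeZero d := ⟨by omega⟩
  have hd2 : 2 ≤ d := by omega
  have hd' : (3 : ℝ) ≤ d := by exact_mod_cast hd
  obtain ⟨hS1, hS2⟩ := siteWeight_bounds hd2
  set q : ℝ := nawMemGrowth d 4 ^ 6 - 1 / 2 with hq
  have hlam2 : (2 : ℝ) ≤ nawMemGrowth d 4 := by linarith
  have hq1 : (1 : ℝ) < q := by
    have : (2 : ℝ) ^ 6 ≤ nawMemGrowth d 4 ^ 6 := pow_le_pow_left₀ (by norm_num) hlam2 6
    rw [hq]; nlinarith
  have hq0 : 0 < q := by linarith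
  have hμ6 : 0 < nawMemGrowth d 6 := nawMemGrowth_pos 6
  set K : ℝ := 2 * (2 * d) ^ 2 with hK
  have hK0 : 0 < K := by rw [hK]; positivity
  have hj : ∀ j : ℕ, nawMemGrowth d 6 ^ (6 * j + 2) ≤ K * q ^ j := fun j =>
    (pow_nawMemGrowth_le d 6 (by omega)).trans (nawMemCount_six_le hd j)
  by_contra hcon
  have hlt : q < nawMemGrowth d 6 ^ 6 := lt_of_not_ge hcon
  have hr : 1 < nawMemGrowth d 6 ^ 6 / q := (one_lt_div hq0).2 hlt
  obtain ⟨j, hjK⟩ := pow_unbounded_of_one_lt (K / nawMemGrowth d 6 ^ 2) hr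
  have h1 := hj j
  have h2 : nawMemGrowth d 6 ^ (6 * j + 2) = nawMemGrowth d 6 ^ 2 * (nawMemGrowth d 6 ^ 6 / q) ^ j * q ^ j := by
    rw [div_pow, pow_add, pow_mul]
    field_simp
  rw [h2] at h1
  have h3 : nawMemGrowth d 6 ^ 2 * (nawMemGrowth d 6 ^ 6 / q) ^ j ≤ K :=
    le_of_mul_le_mul_right (by linarith [h1]) (pow_pos hq0 j)
  have h4 : (nawMemGrowth d 6 ^ 6 / q) ^ j ≤ K / nawMemGrowth d 6 ^ 2 := by
    rw [le_div_iff₀ (pow_pos hμ6 2)]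
    linarith [h3]
  linarith

/-- **Strict monotonicity of the site hierarchy at the second rung: `μ^N_6(d) < μ^N_4(d)`**, every `d ≥ 3`. [folklore] -/
theorem nawMemGrowth_six_lt_four (hd : 3 ≤ d) : nawMemGrowth d 6 < nawMemGrowth d 4 := by
  have h := nawMemGrowth_six_pow_six_le hd
  have h6 : nawMemGrowth d 6 ^ 6 < nawMemGrowth d 4 ^ 6 := by linarith
  exact lt_of_pow_lt_pow_left₀ 6 (nawMemGrowth_nonneg d 4) h6

/-- **`Δ^N_6(d) > 0`** for every `d ≥ 3`: forbidding the chordless hexagons costs the site hierarchy strictly. [folklore] -/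
theorem siteLoopCost_six_pos (hd : 3 ≤ d) : 0 < siteLoopCost d 6 := by
  haveI : NeZero d := ⟨by omega⟩
  unfold siteLoopCost
  rw [show (6 : ℕ) - 2 = 4 from rfl]
  exact Real.log_pos ((one_lt_div (nawMemGrowth_pos 6)).2 (nawMemGrowth_six_lt_four hd))

/-- **`R^N_6(d) > 0`** for every `d ≥ 3` — the lower half of the typed site window at the second rung. [folklore] -/
theorem siteLoopCompat_six_pos (hd : 3 ≤ d) : 0 < siteLoopCompat d 6 := by
  haveI : NeZero d := ⟨by omega⟩
  have hf : 0 < siteLoopDensity d 6 := by simpa using siteLoopDensity_even_pos (d := d) hd (m := 3) (by norm_num)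
  exact div_pos (siteLoopCost_six_pos hd) hf

/-- The `m = 3` instance of the LOWER inequality of the typed conjecture `siteLoopCompatWindow`: `0 < R^N_6(d)`, `d ≥ 3`.
[folklore] -/
theorem siteLoopCompatWindow_rung_six_left (d : ℕ) (hd : 3 ≤ d) : 0 < siteLoopCompat d (2 * 3) :=
  siteLoopCompat_six_pos hd

end Summit.CriticalPhenomena.PercolationContinuityZ3.Theorems.Pcint.NawTail
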